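import Literature.MathematicalPhysics.KineticTheory.ReyBelletThomas2002CrossScaling
import HarnessLib

/-!
# Rey-Bellet–Thomas 2002 with `k₁ < k₂`: the dissipation bound when the pinning dominates

Trunk T-KINETIC (Literature/MathematicalPhysics/KineticTheory). Inline step towards Theorem 3.10 / 2.1
of Rey-Bellet–Thomas, CMP **225** (2002), for the named fact `ReyBelletThomas2002_thm21` in the
regime `k₁ < k₂`, following the PINNING-DOMINATED half of the two-regime repair of
Cuneo–Eckmann–Hairer–Rey-Bellet, EJP **23** (2018) §5.2 (arXiv:1712.09413) — "the rescaled system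
behaves like a tight molecule … the way around [the fast internal oscillations] is to consider the
center of mass coordinates" — adapted to the Rey-Bellet–Thomas reservoirs and proved by SEQUENTIAL
COMPACTNESS:

rescale with the pinning exponent `k₁` (time `t_p = E^{1/k₁-1/2}`); on `{G̃_E ≤ M}` positions and
momenta are bounded and bond lengths are `O(E^{1/k₂-1/k₁}) → 0`
(`ReyBelletThomas2002CrossScaling.lean`), but the bond forces are stiff, so only the CENTRE OF MASS
`S = ∑ q̃_i`, `P = ∑ p̃_i` is followed: `S' = P`, `P' = -∑ Ũ_E'(q̃_i) - E^{2/k₁-1}Λ(r̃_L + r̃_R)`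
(the bond forces telescope, `sum_rbForceOf`), `r̃_L = r̃_L(0) + η̃_L - E^{1/k₁-1/2}γ∫r̃_L + Λ(q̃_0 - q̃_0(0))`.
Along `E_n → ∞` with controls `η̃_n → 0` and dissipation `∫|r̃_n|² → 0`, `(S_n, P_n, r̃_n - η̃_n)`
are bounded and equi-Lipschitz; a subsequence converges (Arzelà–Ascoli), every `q̃_i` converges to
`Q = S/N` (tight molecule), the limit has `r ≡ 0`, hence `Q` is constant (reservoir equation,
`Λ ≠ 0`), `P ≡ 0`, and `U_∞'(Q(0)) = 0`, i.e. `Q(0) = 0` — so the rescaled pinning energies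
`∑ Ũ_{E_n}(q̃_i(0)) → N U_∞(0) = 0`, contradicting `H̃_pin ≥ H̃_int` (the regime) and `G̃ ≥ 1/2`.

* `pinning_core_seq` — the sequential contradiction;
* `pinning_dissipation_lower_bound` — **CEHR Prop. 5.3 in the pinning regime / RBT Cor. 3.6,
  quantitative rescaled form**: `E₀, δ₀, ε₁ > 0` with `∫₀^{Λ₀}(r̃_L² + r̃_R²) ≥ ε₁` for `E ≥ E₀`
  and every rescaled (exponent `k₁`) controlled trajectory on `[0, Λ₀]` with `G̃_E(x̃(0)) ≥ 1/2`,
  `H̃_int(x̃(0)) ≤ H̃_pin(x̃(0))`, `G̃_E ≤ M` along the path and `sup ‖η̃‖ ≤ δ₀`.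

## References

* L. Rey-Bellet, L. E. Thomas, Comm. Math. Phys. **225** (2002) 305–329, Thm 3.3, Cor 3.6.
* N. Cuneo, J.-P. Eckmann, M. Hairer, L. Rey-Bellet, Electron. J. Probab. **23** (2018) no. 55,
  §5.2: Assumption 5.18, Remark 5.19, (5.16), (5.17), Lemma 5.20, Prop. 5.21, Lemma 5.22.
-/

noncomputable section

open MeasureTheory Filter Topology Set intervalIntegral Metric
open scoped NNReal

namespace Literature.MathematicalPhysics.KineticTheory.HeatConduction

open Literature.Analysis.ODE Literature.MathematicalPhysics.KineticTheory

variable {N : ℕ}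

/-! ### Bookkeeping -/

/-- Component bounds give a norm bound on `ℝ × ℝ × ℝ × ℝ` (sup norm). [folklore] -/
theorem norm_prod4_le {w : ℝ × ℝ × ℝ × ℝ} {C : ℝ} (h1 : |w.1| ≤ C) (h2 : |w.2.1| ≤ C)
    (h3 : |w.2.2.1| ≤ C) (h4 : |w.2.2.2| ≤ C) : ‖w‖ ≤ C := by
  simp only [Prod.norm_def, Real.norm_eq_abs]
  exact max_le h1 (max_le h2 (max_le h3 h4))

/-- Components are bounded by the norm on `ℝ × ℝ × ℝ × ℝ`. [folklore] -/
theorem abs_le_norm_prod4 (w : ℝ × ℝ × ℝ × ℝ) :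
    |w.1| ≤ ‖w‖ ∧ |w.2.1| ≤ ‖w‖ ∧ |w.2.2.1| ≤ ‖w‖ ∧ |w.2.2.2| ≤ ‖w‖ := by
  refine ⟨?_, ?_, ?_, ?_⟩
  · rw [← Real.norm_eq_abs]; exact norm_fst_le w
  · rw [← Real.norm_eq_abs]; exact (norm_fst_le w.2).trans (norm_snd_le w)
  · rw [← Real.norm_eq_abs]; exact ((norm_fst_le w.2.2).trans (norm_snd_le w.2)).trans (norm_snd_le w)
  · rw [← Real.norm_eq_abs]; exact ((norm_snd_le w.2.2).trans (norm_snd_le w.2)).trans (norm_snd_le w)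

/-- The end-site selector sum picks the head momentum: `∑_i [i = 0] f_i = f_0`. [folklore] -/
theorem sum_ite_val_eq_zero (hN : 0 < N) (f : Fin N → ℝ) :
    ∑ i : Fin N, (if i.val = 0 then f i else 0) = f ⟨0, hN⟩ := by
  rw [Finset.sum_eq_single ⟨0, hN⟩]
  · simp
  · intro j _ hj
    rw [if_neg]
    intro h0
    exact hj (Fin.ext h0)
  · intro h; exact absurd (Finset.mem_univ _) h

/-- A selector sum of bounded terms is at most `N C` in absolute value. [folklore] -/
theorem abs_sum_ite_le {f : Fin N → ℝ} {C : ℝ} (hC : 0 ≤ C) (hf : ∀ i, |f i| ≤ C)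
    (c : Fin N → Prop) [DecidablePred c] : |∑ i : Fin N, (if c i then f i else 0)| ≤ N * C := by
  refine (Finset.abs_sum_le_sum_abs _ _).trans ?_
  have : ∀ i ∈ (Finset.univ : Finset (Fin N)), |(if c i then f i else 0)| ≤ C := fun i _ => by
    split_ifs
    · exact hf i
    · simp [hC]
  refine (Finset.sum_le_sum this).trans ?_
  simp

/-- **Tight molecule**: if all sites are within `D` of each other then each site is within `D` of
the centre of mass `(∑ q_j)/N`. [folklore] -/
theorem abs_sub_mean_le {q : Fin N → ℝ} {D : ℝ} (hN : 0 < N) (h : ∀ i j : Fin N, |q i - q j| ≤ D)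
    (i : Fin N) : |q i - (∑ j, q j) / N| ≤ D := by
  have hN' : (0 : ℝ) < N := by exact_mod_cast hN
  have e : q i - (∑ j, q j) / N = (∑ j, (q i - q j)) / N := by
    rw [Finset.sum_sub_distrib, Finset.sum_const, Finset.card_univ, Fintype.card_fin, nsmul_eq_mul]
    field_simp
  rw [e, abs_div, abs_of_pos hN', div_le_iff₀ hN']
  calc |∑ j, (q i - q j)| ≤ ∑ j, |q i - q j| := Finset.abs_sum_le_sum_abs _ _
    _ ≤ ∑ _j : Fin N, D := Finset.sum_le_sum fun j _ => h i j
    _ = D * N := by simp; ring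

/-- **Reservoir variables move slowly (componentwise form)**: for `x = x(0) + (0, η) + ∫ F(x)` on
`[0, T]` with `|F(x(s))_{r_b}| ≤ M_r`, `|r_b(s) - r_b(0) - η_b(s)| ≤ M_r T` — no bound on the other
components of the drift is needed (the bond forces may be stiff). [folklore] -/
theorem reservoir_deviation_le' {F : RBPhaseSpace N → RBPhaseSpace N}
    {x : ℝ → RBPhaseSpace N} {η : ℝ → ℝ × ℝ} {T Mr : ℝ}
    (hFc : Continuous fun s => F (x s))
    (hx : IsIntegralSolutionOn F (fun s => x 0 + ((0 : PhaseSpace N), η s)) x T)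
    (hb : ∀ s ∈ Icc 0 T, |(F (x s)).2.1| ≤ Mr ∧ |(F (x s)).2.2| ≤ Mr) :
    ∀ s ∈ Icc 0 T, |(x s).2.1 - (x 0).2.1 - (η s).1| ≤ Mr * T ∧
      |(x s).2.2 - (x 0).2.2 - (η s).2| ≤ Mr * T := by
  intro s hs
  have hMr : 0 ≤ Mr := (abs_nonneg _).trans (hb 0 ⟨le_rfl, hs.1.trans hs.2⟩).1
  have h1 := hx s hs
  obtain ⟨-, -, e21, e22⟩ := integral_rbPhaseSpace_apply hFc 0 s
  have c1 : (x s).2.1 - (x 0).2.1 - (η s).1 = ∫ u in (0:ℝ)..s, (F (x u)).2.1 := by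
    have := congrArg (fun v : RBPhaseSpace N => v.2.1) h1
    simp only [Prod.snd_add, Prod.fst_add] at this
    rw [← e21]; linarith
  have c2 : (x s).2.2 - (x 0).2.2 - (η s).2 = ∫ u in (0:ℝ)..s, (F (x u)).2.2 := by
    have := congrArg (fun v : RBPhaseSpace N => v.2.2) h1
    simp only [Prod.snd_add] at this
    rw [← e22]; linarith
  have hI : ∀ (f : ℝ → ℝ), (∀ u ∈ Icc 0 T, |f u| ≤ Mr) → |∫ u in (0:ℝ)..s, f u| ≤ Mr * T := by
    intro f hf
    have := intervalIntegral.norm_integral_le_of_norm_le_const (a := 0) (b := s) (f := f) (C := Mr)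
      fun u hu => by
        rw [Set.uIoc_of_le hs.1] at hu
        rw [Real.norm_eq_abs]; exact hf u ⟨hu.1.le, hu.2.trans hs.2⟩
    rw [Real.norm_eq_abs, sub_zero, abs_of_nonneg hs.1] at this
    exact this.trans (mul_le_mul_of_nonneg_left hs.2 hMr)
  rw [c1, c2]
  exact ⟨hI _ fun u hu => (hb u hu).1, hI _ fun u hu => (hb u hu).2⟩

/-- The limiting potential `a|y|^k` is continuous (`k > 0`). [folklore] -/
theorem RBGrowth.continuous_limitPot (a : ℝ) {k : ℝ} (hk : 0 < k) : Continuous (RBGrowth.limitPot a k) := by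
  unfold RBGrowth.limitPot
  exact continuous_const.mul (continuous_abs.rpow_const fun _ => Or.inr hk.le)

/-! ### The compactness–contradiction argument in the pinning regime -/

section Core

variable {P : OscillatorChain} {k₁ k₂ : ℝ} (hU : RBGrowth P.U k₁) (hV : RBGrowth P.V k₂)
  (hk₁ : 2 ≤ k₁) (hk : k₁ < k₂) {Λ : ℝ} (hΛ : Λ ≠ 0) (hN : 0 < N) {Λ₀ : ℝ} (hΛ₀ : 0 < Λ₀)
include hU hV hk₁ hk hΛ hN hΛ₀

/-- **The compactness core in the pinning regime (sequential form; CEHR §5.2 for the RBT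
reservoirs).** Along any sequence `E_n → ∞`, rescaled (exponent `k₁`) controlled trajectories
`x̃_n = x̃_n(0) + (0, η̃_n) + ∫ Ỹ_{E_n}(x̃_n)` on `[0, Λ₀]` with rescaled energy `≥ 1/2` initially,
kinetic+interaction energy at most the pinning energy initially, energy `≤ M` throughout, bounded
initial reservoir variables and controls `η̃_n → 0` uniformly CANNOT have dissipation
`∫₀^{Λ₀} |r̃_n|² → 0`: the centre-of-mass data `(∑q̃, ∑p̃, r̃ - η̃)` have a uniformly convergent
subsequence (Arzelà–Ascoli); every position converges to the limiting centre of mass `Q` (tight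
molecule); the limit has `r ≡ 0`, so `Q` is constant (reservoir equation), the total momentum
vanishes and `U_∞'(Q(0)) = 0`, i.e. `Q(0) = 0`; hence the rescaled pinning energies at time `0`
tend to `N U_∞(0) = 0`, contradicting `H̃_pin ≥ (G̃ - E^{2/k₁-1}|r̃(0)|²/2)/2 → ≥ 1/4`.
[cite: ReyBelletThomas2002, Thm 3.3 & Cor 3.6 (proof)] -/
theorem pinning_core_seq {M R₀ : ℝ} {Es δ : ℕ → ℝ} {x : ℕ → ℝ → RBPhaseSpace N} {η : ℕ → ℝ → ℝ × ℝ}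
    (hE1 : ∀ n, 1 ≤ Es n) (hE : Tendsto Es atTop atTop) (hδ : Tendsto δ atTop (𝓝 0))
    (hδ1 : ∀ n, δ n ≤ 1) (hxc : ∀ n, Continuous (x n))
    (hsol : ∀ n, IsIntegralSolutionOn
      ((P.rbScaled k₁ (Es n)).rbDriftGen Λ N (Es n ^ (2 / k₁ - 1)) (Es n ^ (1 / k₁ - 1 / 2)))
      (fun s => x n 0 + ((0 : PhaseSpace N), η n s)) (x n) Λ₀)
    (hG0 : ∀ n, 1 / 2 ≤ P.rbScaledEnergy k₁ (Es n) N (x n 0))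
    (hreg : ∀ n, (P.rbScaled k₁ (Es n)).intEnergy N (x n 0).1 ≤ (P.rbScaled k₁ (Es n)).pinEnergy N (x n 0).1.1)
    (hr0 : ∀ n, |(x n 0).2.1| ≤ R₀ ∧ |(x n 0).2.2| ≤ R₀)
    (hηb : ∀ n, ∀ s ∈ Icc 0 Λ₀, ‖η n s‖ ≤ δ n)
    (hGM : ∀ n, ∀ s ∈ Icc 0 Λ₀, P.rbScaledEnergy k₁ (Es n) N (x n s) ≤ M) :
    ¬ Tendsto (fun n => ∫ s in (0 : ℝ)..Λ₀, ((x n s).2.1 ^ 2 + (x n s).2.2 ^ 2)) atTop (𝓝 0) := by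
  intro hdiss
  have hk₁0 : 0 < k₁ := by linarith
  have hN' : (0 : ℝ) < N := by exact_mod_cast hN
  have hNne : (N : ℝ) ≠ 0 := hN'.ne'
  -- constants
  obtain ⟨B, BΔ, Cp, Cr, MU, hB, hBΔ, hCp, hCr, hMU, hbd⟩ :=
    pinning_scaled_apriori (N := N) hU hV hk₁ hk.le M
  have hR₀ : 0 ≤ R₀ := (abs_nonneg _).trans (hr0 0).1
  have hE0 : ∀ n, 0 < Es n := fun n => by linarith [hE1 n]
  have hΛ' := abs_nonneg Λ
  have hγ' := abs_nonneg P.γ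
  -- the reservoir coefficients are at most `1`
  have hcp1 : ∀ n, Es n ^ (2 / k₁ - 1) ≤ 1 := fun n =>
    Real.rpow_le_one_of_one_le_of_nonpos (hE1 n) (by
      have : 2 / k₁ ≤ 1 := by rw [div_le_one hk₁0]; exact hk₁
      linarith)
  have hcp0 : ∀ n, 0 ≤ Es n ^ (2 / k₁ - 1) := fun n => Real.rpow_nonneg (hE0 n).le _
  have hcr1 : ∀ n, Es n ^ (1 / k₁ - 1 / 2) ≤ 1 := fun n =>
    Real.rpow_le_one_of_one_le_of_nonpos (hE1 n) (by
      have : 1 / k₁ ≤ 1 / 2 := by rw [div_le_div_iff₀ hk₁0 (by norm_num)]; linarith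
      linarith)
  have hcr0 : ∀ n, 0 ≤ Es n ^ (1 / k₁ - 1 / 2) := fun n => Real.rpow_nonneg (hE0 n).le _
  -- the drift, its components and their continuity
  set Y : ℕ → RBPhaseSpace N → RBPhaseSpace N := fun n =>
    (P.rbScaled k₁ (Es n)).rbDriftGen Λ N (Es n ^ (2 / k₁ - 1)) (Es n ^ (1 / k₁ - 1 / 2)) with hY
  have hYc : ∀ n, Continuous (Y n) := fun n =>
    continuous_rbDriftGen_rbScaled₂ hU hV k₁ (hE0 n) Λ N _ _
  have hYxc : ∀ n, Continuous fun s => Y n (x n s) := fun n => (hYc n).comp (hxc n)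
  have hY11 : ∀ n z i, (Y n z).1.1 i = z.1.2 i := fun n z i => rfl
  have hY21 : ∀ n z, (Y n z).2.1 = -(Es n ^ (1 / k₁ - 1 / 2) * P.γ * z.2.1) +
      Λ * ∑ i : Fin N, (if i.val = 0 then z.1.2 i else 0) := fun n z => rfl
  have hY22 : ∀ n z, (Y n z).2.2 = -(Es n ^ (1 / k₁ - 1 / 2) * P.γ * z.2.2) +
      Λ * ∑ i : Fin N, (if i.val = N - 1 then z.1.2 i else 0) := fun n z => rfl
  have hY12 : ∀ n z, ∑ i, (Y n z).1.2 i = -(∑ i, deriv (RBGrowth.scaledPot P.U k₁ (Es n)) (z.1.1 i)) -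
      Es n ^ (2 / k₁ - 1) * Λ * ∑ i : Fin N, ((if i.val = 0 then z.2.1 else 0) + (if i.val = N - 1 then z.2.2 else 0)) := by
    intro n z
    have e : ∀ i, (Y n z).1.2 i = -rbForceOf (deriv (RBGrowth.scaledPot P.U k₁ (Es n)))
        (deriv (RBGrowth.scaledPot P.V k₁ (Es n))) N i z.1.1 -
        Es n ^ (2 / k₁ - 1) * Λ * ((if i.val = 0 then z.2.1 else 0) + (if i.val = N - 1 then z.2.2 else 0)) := by
      intro i
      rw [hY]
      simp only
      rw [OscillatorChain.rbDriftGen_eq_rbDriftOf]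
      rfl
    simp only [e, Finset.sum_sub_distrib, Finset.sum_neg_distrib, sum_rbForceOf, ← Finset.mul_sum]
  -- a-priori bounds along the trajectories
  have hxb : ∀ n, ∀ s ∈ Icc 0 Λ₀, (∀ i, |(x n s).1.1 i| ≤ B) ∧
      (∀ i j : Fin N, j.val = i.val + 1 → |(x n s).1.1 j - (x n s).1.1 i| ≤ BΔ * Es n ^ (1 / k₂ - 1 / k₁)) ∧
      (∀ i, |(x n s).1.2 i| ≤ Cp) ∧ Es n ^ (1 / k₁ - 1 / 2) * |(x n s).2.1| ≤ Cr ∧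
      Es n ^ (1 / k₁ - 1 / 2) * |(x n s).2.2| ≤ Cr ∧
      (∀ i, |deriv (RBGrowth.scaledPot P.U k₁ (Es n)) ((x n s).1.1 i)| ≤ MU) :=
    fun n s hs => hbd (Es n) (hE1 n) (x n s) (hGM n s hs)
  have h0m : (0 : ℝ) ∈ Icc 0 Λ₀ := ⟨le_rfl, hΛ₀.le⟩
  have hΛm : Λ₀ ∈ Icc 0 Λ₀ := ⟨hΛ₀.le, le_rfl⟩
  have hη1 : ∀ n, ∀ s ∈ Icc 0 Λ₀, |(η n s).1| ≤ δ n ∧ |(η n s).2| ≤ δ n := fun n s hs =>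
    ⟨((Real.norm_eq_abs _).symm.le.trans (norm_fst_le (η n s))).trans (hηb n s hs),
      ((Real.norm_eq_abs _).symm.le.trans (norm_snd_le (η n s))).trans (hηb n s hs)⟩
  -- the `ṙ`-components of the drift are bounded by `M_r`
  set Mr : ℝ := |P.γ| * Cr + |Λ| * (N * Cp) with hMr
  have hMr0 : 0 ≤ Mr := by positivity
  have hYr : ∀ n, ∀ s ∈ Icc 0 Λ₀, |(Y n (x n s)).2.1| ≤ Mr ∧ |(Y n (x n s)).2.2| ≤ Mr := by
    intro n s hs
    obtain ⟨-, -, hp, hr1, hr2, -⟩ := hxb n s hs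
    constructor
    · rw [hY21]
      refine (abs_add_le _ _).trans ?_
      rw [abs_neg, abs_mul, abs_mul, abs_of_nonneg (hcr0 n), abs_mul]
      have h1 : Es n ^ (1 / k₁ - 1 / 2) * |P.γ| * |(x n s).2.1| ≤ |P.γ| * Cr := by
        rw [mul_comm (Es n ^ (1 / k₁ - 1 / 2)) |P.γ|, mul_assoc]
        exact mul_le_mul_of_nonneg_left hr1 hγ'
      have h2 : |Λ| * |∑ i : Fin N, (if i.val = 0 then (x n s).1.2 i else 0)| ≤ |Λ| * (N * Cp) :=
        mul_le_mul_of_nonneg_left (abs_sum_ite_le hCp hp _) hΛ'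
      rw [hMr]; linarith
    · rw [hY22]
      refine (abs_add_le _ _).trans ?_
      rw [abs_neg, abs_mul, abs_mul, abs_of_nonneg (hcr0 n), abs_mul]
      have h1 : Es n ^ (1 / k₁ - 1 / 2) * |P.γ| * |(x n s).2.2| ≤ |P.γ| * Cr := by
        rw [mul_comm (Es n ^ (1 / k₁ - 1 / 2)) |P.γ|, mul_assoc]
        exact mul_le_mul_of_nonneg_left hr2 hγ'
      have h2 : |Λ| * |∑ i : Fin N, (if i.val = N - 1 then (x n s).1.2 i else 0)| ≤ |Λ| * (N * Cp) :=
        mul_le_mul_of_nonneg_left (abs_sum_ite_le hCp hp _) hΛ'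
      rw [hMr]; linarith
  -- the reservoir variables: componentwise integral equations and a uniform bound
  have hrIE : ∀ n, ∀ s ∈ Icc 0 Λ₀,
      (x n s).2.1 = (x n 0).2.1 + (η n s).1 + ∫ u in (0:ℝ)..s, (Y n (x n u)).2.1 ∧
      (x n s).2.2 = (x n 0).2.2 + (η n s).2 + ∫ u in (0:ℝ)..s, (Y n (x n u)).2.2 := by
    intro n s hs
    have h1 := hsol n s hs
    obtain ⟨-, -, e21, e22⟩ := integral_rbPhaseSpace_apply (hYxc n) 0 s
    constructor
    · have := congrArg (fun v : RBPhaseSpace N => v.2.1) h1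
      simp only [Prod.snd_add, Prod.fst_add] at this
      rw [← e21]; exact this
    · have := congrArg (fun v : RBPhaseSpace N => v.2.2) h1
      simp only [Prod.snd_add] at this
      rw [← e22]; exact this
  set R₁ : ℝ := R₀ + 1 + Mr * Λ₀ with hR₁
  have hR₁0 : 0 ≤ R₁ := by rw [hR₁]; positivity
  have hrb : ∀ n, ∀ s ∈ Icc 0 Λ₀, |(x n s).2.1| ≤ R₁ ∧ |(x n s).2.2| ≤ R₁ := by
    intro n s hs
    obtain ⟨d1, d2⟩ := reservoir_deviation_le' (hYxc n) (hsol n) (hYr n) s hs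
    obtain ⟨hη1s, hη2s⟩ := hη1 n s hs
    constructor
    · have e : (x n s).2.1 = ((x n s).2.1 - (x n 0).2.1 - (η n s).1) + (x n 0).2.1 + (η n s).1 := by ring
      rw [e]
      refine (abs_add_le _ _).trans ((add_le_add (abs_add_le _ _) le_rfl).trans ?_)
      rw [hR₁]; linarith only [d1, hη1s, (hr0 n).1, hδ1 n]
    · have e : (x n s).2.2 = ((x n s).2.2 - (x n 0).2.2 - (η n s).2) + (x n 0).2.2 + (η n s).2 := by ring
      rw [e]
      refine (abs_add_le _ _).trans ((add_le_add (abs_add_le _ _) le_rfl).trans ?_)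
      rw [hR₁]; linarith only [d2, hη2s, (hr0 n).2, hδ1 n]
  -- the positions: componentwise integral equation `q̃_i(s) = q̃_i(0) + ∫ p̃_i`
  have hqIE : ∀ n, ∀ s ∈ Icc 0 Λ₀, ∀ i, (x n s).1.1 i = (x n 0).1.1 i + ∫ u in (0:ℝ)..s, (x n u).1.2 i := by
    intro n s hs i
    have h1 := hsol n s hs
    obtain ⟨e11, -, -, -⟩ := integral_rbPhaseSpace_apply (hYxc n) 0 s
    have := congrArg (fun v : RBPhaseSpace N => v.1.1 i) h1
    simp only [Prod.fst_add, Pi.add_apply, add_zero] at this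
    rw [this, e11]
    rfl
  -- the total momentum: `P(s) = P(0) + ∫ F`, `F = ∑_i Ỹ_{p_i}`
  set Sq : ℕ → ℝ → ℝ := fun n s => ∑ i, (x n s).1.1 i with hSq
  set Pm : ℕ → ℝ → ℝ := fun n s => ∑ i, (x n s).1.2 i with hPm
  set F : ℕ → ℝ → ℝ := fun n u => ∑ i, (Y n (x n u)).1.2 i with hF
  have hPmc : ∀ n, Continuous (Pm n) := fun n =>
    continuous_finsetSum _ fun i _ => (continuous_apply i).comp (continuous_snd.comp (continuous_fst.comp (hxc n)))
  have hFc : ∀ n, Continuous (F n) := fun n =>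
    continuous_finsetSum _ fun i _ => (continuous_apply i).comp (continuous_snd.comp (continuous_fst.comp (hYxc n)))
  have hSIE : ∀ n, ∀ s ∈ Icc 0 Λ₀, Sq n s = Sq n 0 + ∫ u in (0:ℝ)..s, Pm n u := by
    intro n s hs
    simp only [hSq, hPm]
    rw [intervalIntegral.integral_finsetSum (f := fun i u => (x n u).1.2 i) fun i _ =>
      (((continuous_apply i).comp (continuous_snd.comp (continuous_fst.comp (hxc n)))).intervalIntegrable _ _),
      ← Finset.sum_add_distrib]
    exact Finset.sum_congr rfl fun i _ => hqIE n s hs i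
  have hPIE : ∀ n, ∀ s ∈ Icc 0 Λ₀, Pm n s = Pm n 0 + ∫ u in (0:ℝ)..s, F n u := by
    intro n s hs
    have h1 := hsol n s hs
    obtain ⟨-, e12, -, -⟩ := integral_rbPhaseSpace_apply (hYxc n) 0 s
    simp only [hPm, hF]
    rw [intervalIntegral.integral_finsetSum (f := fun i u => (Y n (x n u)).1.2 i) fun i _ =>
      (((continuous_apply i).comp (continuous_snd.comp (continuous_fst.comp (hYxc n)))).intervalIntegrable _ _),
      ← Finset.sum_add_distrib]
    refine Finset.sum_congr rfl fun i _ => ?_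
    have := congrArg (fun v : RBPhaseSpace N => v.1.2 i) h1
    simp only [Prod.fst_add, Prod.snd_add, Pi.add_apply, add_zero] at this
    rw [this, e12]
  -- bounds: `|S| ≤ N B`, `|P| ≤ N C_p`, `|F| ≤ M_P`
  set MP : ℝ := N * MU + |Λ| * (N * (R₁ + R₁)) with hMP
  have hMP0 : 0 ≤ MP := by positivity
  have hSb : ∀ n, ∀ s ∈ Icc 0 Λ₀, |Sq n s| ≤ N * B := fun n s hs => by
    refine (Finset.abs_sum_le_sum_abs _ _).trans ?_
    refine (Finset.sum_le_sum fun i _ => (hxb n s hs).1 i).trans ?_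
    simp
  have hPb : ∀ n, ∀ s ∈ Icc 0 Λ₀, |Pm n s| ≤ N * Cp := fun n s hs => by
    refine (Finset.abs_sum_le_sum_abs _ _).trans ?_
    refine (Finset.sum_le_sum fun i _ => (hxb n s hs).2.2.1 i).trans ?_
    simp
  have hRsel : ∀ n, ∀ s ∈ Icc 0 Λ₀,
      |∑ i : Fin N, ((if i.val = 0 then (x n s).2.1 else 0) + (if i.val = N - 1 then (x n s).2.2 else 0))| ≤
        N * (|(x n s).2.1| + |(x n s).2.2|) := by
    intro n s _
    refine (Finset.abs_sum_le_sum_abs _ _).trans ?_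
    have : ∀ i ∈ (Finset.univ : Finset (Fin N)),
        |(if i.val = 0 then (x n s).2.1 else 0) + (if i.val = N - 1 then (x n s).2.2 else 0)| ≤
          |(x n s).2.1| + |(x n s).2.2| := fun i _ => by
      refine (abs_add_le _ _).trans (add_le_add ?_ ?_) <;> split_ifs <;> simp
    refine (Finset.sum_le_sum this).trans ?_
    rw [Finset.sum_const, Finset.card_univ, Fintype.card_fin, nsmul_eq_mul]
  have hFb : ∀ n, ∀ s ∈ Icc 0 Λ₀, |F n s| ≤ MP := by
    intro n s hs
    simp only [hF]
    rw [hY12]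
    obtain ⟨-, -, -, -, -, hUf⟩ := hxb n s hs
    obtain ⟨hr1, hr2⟩ := hrb n s hs
    have h1 : |∑ i, deriv (RBGrowth.scaledPot P.U k₁ (Es n)) ((x n s).1.1 i)| ≤ N * MU := by
      refine (Finset.abs_sum_le_sum_abs _ _).trans ((Finset.sum_le_sum fun i _ => hUf i).trans ?_)
      simp
    have h2 : |Es n ^ (2 / k₁ - 1) * Λ * ∑ i : Fin N, ((if i.val = 0 then (x n s).2.1 else 0) +
        (if i.val = N - 1 then (x n s).2.2 else 0))| ≤ |Λ| * (N * (R₁ + R₁)) := by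
      rw [abs_mul, abs_mul, abs_of_nonneg (hcp0 n)]
      have h3 := hRsel n s hs
      calc Es n ^ (2 / k₁ - 1) * |Λ| * |∑ i : Fin N, ((if i.val = 0 then (x n s).2.1 else 0) +
            (if i.val = N - 1 then (x n s).2.2 else 0))|
          ≤ 1 * |Λ| * (N * (|(x n s).2.1| + |(x n s).2.2|)) := by
            gcongr
            exact hcp1 n
        _ ≤ |Λ| * (N * (R₁ + R₁)) := by
            rw [one_mul]
            exact mul_le_mul_of_nonneg_left (mul_le_mul_of_nonneg_left (add_le_add hr1 hr2) hN'.le) hΛ'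
    refine (abs_sub _ _).trans ?_
    rw [abs_neg, hMP]
    exact add_le_add h1 h2
  -- integral increments of bounded integrands
  have hincr : ∀ (f : ℝ → ℝ) (C : ℝ), Continuous f → (∀ u ∈ Icc 0 Λ₀, |f u| ≤ C) →
      ∀ s ∈ Icc 0 Λ₀, ∀ t ∈ Icc 0 Λ₀, |(∫ u in (0:ℝ)..t, f u) - ∫ u in (0:ℝ)..s, f u| ≤ C * |t - s| := by
    intro f C hf hfb s hs t ht
    rw [intervalIntegral.integral_interval_sub_left (hf.intervalIntegrable _ _) (hf.intervalIntegrable _ _)]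
    have := intervalIntegral.norm_integral_le_of_norm_le_const (a := s) (b := t) (f := f) (C := C) fun u hu => by
      rw [Real.norm_eq_abs]
      refine hfb u ?_
      rcases le_total s t with hst | hst
      · rw [Set.uIoc_of_le hst] at hu; exact ⟨hs.1.trans hu.1.le, hu.2.trans ht.2⟩
      · rw [Set.uIoc_of_ge hst] at hu; exact ⟨ht.1.trans hu.1.le, hu.2.trans hs.2⟩
    rwa [Real.norm_eq_abs] at this
  -- the centre-of-mass data `w_n = (S, P, r̃_L - η_L, r̃_R - η_R)`
  set w : ℕ → ℝ → ℝ × ℝ × ℝ × ℝ := fun n s =>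
    (Sq n s, Pm n s, (x n s).2.1 - (η n s).1, (x n s).2.2 - (η n s).2) with hw
  have hρIE : ∀ n, ∀ s ∈ Icc 0 Λ₀, (w n s).2.2.1 = (x n 0).2.1 + ∫ u in (0:ℝ)..s, (Y n (x n u)).2.1 ∧
      (w n s).2.2.2 = (x n 0).2.2 + ∫ u in (0:ℝ)..s, (Y n (x n u)).2.2 := by
    intro n s hs
    obtain ⟨e1, e2⟩ := hrIE n s hs
    simp only [hw]
    constructor <;> linarith
  set Cw : ℝ := N * B + N * Cp + (R₁ + 1) with hCw
  have hwbd : ∀ n, ∀ s ∈ Icc 0 Λ₀, ‖w n s‖ ≤ Cw := by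
    intro n s hs
    obtain ⟨hr1, hr2⟩ := hrb n s hs
    obtain ⟨hη1s, hη2s⟩ := hη1 n s hs
    have hNB : 0 ≤ (N : ℝ) * B := by positivity
    have hNC : 0 ≤ (N : ℝ) * Cp := by positivity
    refine norm_prod4_le ?_ ?_ ?_ ?_
    · exact (hSb n s hs).trans (by rw [hCw]; linarith only [hNC, hR₁0])
    · exact (hPb n s hs).trans (by rw [hCw]; linarith only [hNB, hR₁0])
    · show |(x n s).2.1 - (η n s).1| ≤ Cw
      refine (abs_sub _ _).trans ?_; rw [hCw]; linarith only [hr1, hη1s, hδ1 n, hNB, hNC]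
    · show |(x n s).2.2 - (η n s).2| ≤ Cw
      refine (abs_sub _ _).trans ?_; rw [hCw]; linarith only [hr2, hη2s, hδ1 n, hNB, hNC]
  set Lw : ℝ := N * Cp + MP + Mr with hLw
  have hLw0 : 0 ≤ Lw := by positivity
  have hwlip : ∀ n, LipschitzOnWith ⟨Lw, hLw0⟩ (w n) (Icc 0 Λ₀) := by
    intro n
    refine LipschitzOnWith.of_dist_le_mul fun s hs t ht => ?_
    rw [dist_eq_norm, Real.dist_eq]
    have hNC : 0 ≤ (N : ℝ) * Cp := by positivity
    have hts := abs_nonneg (s - t)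
    have e1 : |(w n s).1 - (w n t).1| ≤ N * Cp * |s - t| := by
      show |Sq n s - Sq n t| ≤ N * Cp * |s - t|
      rw [hSIE n s hs, hSIE n t ht, add_sub_add_left_eq_sub]
      exact hincr (Pm n) (N * Cp) (hPmc n) (hPb n) t ht s hs
    have e2 : |(w n s).2.1 - (w n t).2.1| ≤ MP * |s - t| := by
      show |Pm n s - Pm n t| ≤ MP * |s - t|
      rw [hPIE n s hs, hPIE n t ht, add_sub_add_left_eq_sub]
      exact hincr (F n) MP (hFc n) (hFb n) t ht s hs
    have e3 : |(w n s).2.2.1 - (w n t).2.2.1| ≤ Mr * |s - t| := by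
      rw [(hρIE n s hs).1, (hρIE n t ht).1, add_sub_add_left_eq_sub]
      exact hincr _ Mr (continuous_fst.comp (continuous_snd.comp (hYxc n))) (fun u hu => (hYr n u hu).1) t ht s hs
    have e4 : |(w n s).2.2.2 - (w n t).2.2.2| ≤ Mr * |s - t| := by
      rw [(hρIE n s hs).2, (hρIE n t ht).2, add_sub_add_left_eq_sub]
      exact hincr _ Mr (continuous_snd.comp (continuous_snd.comp (hYxc n))) (fun u hu => (hYr n u hu).2) t ht s hs
    have hbig : ∀ a : ℝ, 0 ≤ a → a ≤ Lw → a * |s - t| ≤ Lw * |s - t| := fun a _ ha =>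
      mul_le_mul_of_nonneg_right ha hts
    show ‖w n s - w n t‖ ≤ Lw * |s - t|
    refine norm_prod4_le ?_ ?_ ?_ ?_
    · exact e1.trans (hbig _ hNC (by rw [hLw]; linarith only [hMP0, hMr0]))
    · exact e2.trans (hbig _ hMP0 (by rw [hLw]; linarith only [hNC, hMr0]))
    · exact e3.trans (hbig _ hMr0 (by rw [hLw]; linarith only [hNC, hMP0]))
    · exact e4.trans (hbig _ hMr0 (by rw [hLw]; linarith only [hNC, hMP0]))
  -- Arzelà–Ascoli extraction
  obtain ⟨g, φ, hφ, hgc, -, hconv⟩ := exists_subseq_tendsto_of_lipschitz hΛ₀.le hwbd hwlip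
  have hφt : Tendsto φ atTop atTop := hφ.tendsto_atTop
  have hEφ : Tendsto (fun n => Es (φ n)) atTop atTop := hE.comp hφt
  have hgpt : ∀ u ∈ Icc 0 Λ₀, Tendsto (fun n => w (φ n) u) atTop (𝓝 (g u)) := fun u hu =>
    tendsto_of_forall_eventually_norm_sub_le fun ε hε => (hconv ε hε).mono fun n hn => hn u hu
  -- names for the limit components
  set Sl : ℝ → ℝ := fun s => (g s).1 with hSl
  set Pl : ℝ → ℝ := fun s => (g s).2.1 with hPl
  set ρL : ℝ → ℝ := fun s => (g s).2.2.1 with hρL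
  set ρR : ℝ → ℝ := fun s => (g s).2.2.2 with hρR
  have hSlc : Continuous Sl := continuous_fst.comp hgc
  have hPlc : Continuous Pl := continuous_fst.comp (continuous_snd.comp hgc)
  have hρLc : Continuous ρL := continuous_fst.comp (continuous_snd.comp (continuous_snd.comp hgc))
  have hρRc : Continuous ρR := continuous_snd.comp (continuous_snd.comp (continuous_snd.comp hgc))
  -- componentwise convergence (uniform on `[0, Λ₀]`)
  have HC : ∀ ε > 0, ∀ᶠ n in atTop, ∀ u ∈ Icc 0 Λ₀,
      |Sq (φ n) u - Sl u| ≤ ε ∧ |Pm (φ n) u - Pl u| ≤ ε ∧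
      |(x (φ n) u).2.1 - ρL u| ≤ ε ∧ |(x (φ n) u).2.2 - ρR u| ≤ ε := by
    intro ε hε
    have h2 : ∀ᶠ n in atTop, δ (φ n) < ε / 2 := (hδ.comp hφt).eventually_lt_const (by positivity)
    filter_upwards [hconv (ε / 2) (by positivity), h2] with n h1n h2n u hu
    have hn := h1n u hu
    obtain ⟨a1, a2, a3, a4⟩ := abs_le_norm_prod4 (w (φ n) u - g u)
    obtain ⟨hη1s, hη2s⟩ := hη1 (φ n) u hu
    refine ⟨?_, ?_, ?_, ?_⟩
    · have : (w (φ n) u - g u).1 = Sq (φ n) u - Sl u := rfl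
      rw [← this]; linarith only [a1, hn, hε]
    · have : (w (φ n) u - g u).2.1 = Pm (φ n) u - Pl u := rfl
      rw [← this]; linarith only [a2, hn, hε]
    · have e : (x (φ n) u).2.1 - ρL u = (w (φ n) u - g u).2.2.1 + (η (φ n) u).1 := by
        simp only [hw, hρL, Prod.snd_sub, Prod.fst_sub]; ring
      rw [e]; refine (abs_add_le _ _).trans ?_; linarith only [a3, hn, hη1s, h2n]
    · have e : (x (φ n) u).2.2 - ρR u = (w (φ n) u - g u).2.2.2 + (η (φ n) u).2 := by
        simp only [hw, hρR, Prod.snd_sub]; ring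
      rw [e]; refine (abs_add_le _ _).trans ?_; linarith only [a4, hn, hη2s, h2n]
  -- TIGHT MOLECULE: every position converges to the centre of mass `Q = S/N`
  have hbondφ : Tendsto (fun n => BΔ * Es (φ n) ^ (1 / k₂ - 1 / k₁)) atTop (𝓝 0) := by
    have hpos : 0 < 1 / k₁ - 1 / k₂ := by
      rw [sub_pos]; exact one_div_lt_one_div_of_lt hk₁0 hk
    have h := (tendsto_rpow_neg_atTop hpos).comp hEφ
    have e : (fun n => Es (φ n) ^ (1 / k₂ - 1 / k₁)) = (fun t : ℝ => t ^ (-(1 / k₁ - 1 / k₂))) ∘ fun n => Es (φ n) := by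
      funext n; simp only [Function.comp]; congr 1; ring
    have := h.const_mul BΔ
    rw [mul_zero, ← e] at this
    exact this
  have HQ : ∀ ε > 0, ∀ᶠ n in atTop, ∀ u ∈ Icc 0 Λ₀, ∀ i, |(x (φ n) u).1.1 i - Sl u / N| ≤ ε := by
    intro ε hε
    have h1 := HC (ε / 2 * N) (mul_pos (half_pos hε) hN')
    have h2 := (tendsto_order.1 hbondφ).2 (ε / 2 / (2 * N)) (div_pos (half_pos hε) (mul_pos two_pos hN'))
    filter_upwards [h1, h2] with n h1 h2 u hu i
    obtain ⟨hS, -, -, -⟩ := h1 u hu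
    obtain ⟨-, hbond, -, -, -, -⟩ := hxb (φ n) u hu
    -- all sites within `2N BΔ E^{-α} ≤ ε/2` of each other
    have hall : ∀ i j : Fin N, |(x (φ n) u).1.1 i - (x (φ n) u).1.1 j| ≤ ε / 2 := fun i j =>
      (abs_sub_le_of_bonds (mul_nonneg hBΔ (Real.rpow_nonneg (hE0 _).le _)) hbond i j).trans (by
        have := h2.le
        rw [le_div_iff₀ (mul_pos two_pos hN')] at this
        linarith only [this])
    have hmean := abs_sub_mean_le hN hall i
    have e : (x (φ n) u).1.1 i - Sl u / N =
        ((x (φ n) u).1.1 i - (∑ j, (x (φ n) u).1.1 j) / N) + (Sq (φ n) u - Sl u) / N := by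
      simp only [hSq]; ring
    rw [e]
    refine (abs_add_le _ _).trans ?_
    rw [abs_div, abs_of_pos hN']
    have : |Sq (φ n) u - Sl u| / N ≤ ε / 2 := by
      rw [div_le_iff₀ hN']; exact hS
    linarith only [hmean, this]
  -- the limiting centre of mass stays in `[-B, B]`
  have hQB : ∀ u ∈ Icc 0 Λ₀, |Sl u / N| ≤ B := by
    intro u hu
    have hlim : Tendsto (fun n => Sq (φ n) u / N) atTop (𝓝 (Sl u / N)) :=
      ((continuous_fst.tendsto _).comp (hgpt u hu)).div_const _
    refine le_of_tendsto hlim.abs (Eventually.of_forall fun n => ?_)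
    rw [abs_div, abs_of_pos hN', div_le_iff₀ hN']
    calc |Sq (φ n) u| ≤ N * B := hSb (φ n) u hu
      _ = B * N := mul_comm _ _
  ----------------------------------------------------------------
  -- Step 1: the limit has vanishing reservoir variables
  ----------------------------------------------------------------
  have hρ0 : ∀ t ∈ Icc 0 Λ₀, ρL t = 0 ∧ ρR t = 0 := by
    -- `∫ (ρ_L² + ρ_R²) = lim ∫ (r̃_L² + r̃_R²) = 0`
    set yρ : ℝ → RBPhaseSpace N := fun s => (((0 : Fin N → ℝ), (0 : Fin N → ℝ)), (ρL s, ρR s)) with hyρ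
    have hyρc : Continuous yρ := continuous_const.prodMk (hρLc.prodMk hρRc)
    have hint0 : ∫ s in (0 : ℝ)..Λ₀, ((yρ s).2.1 ^ 2 + (yρ s).2.2 ^ 2) = 0 := by
      have hA := hdiss.comp hφt
      have hB : Tendsto (fun n => ∫ s in (0 : ℝ)..Λ₀, ((x (φ n) s).2.1 ^ 2 + (x (φ n) s).2.2 ^ 2))
          atTop (𝓝 (∫ s in (0 : ℝ)..Λ₀, (ρL s ^ 2 + ρR s ^ 2))) := by
        have hmeas : ∀ n, Continuous fun s => (x (φ n) s).2.1 ^ 2 + (x (φ n) s).2.2 ^ 2 := fun n => by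
          have := hxc (φ n); fun_prop
        refine intervalIntegral.tendsto_integral_filter_of_dominated_convergence (fun _ => R₁ ^ 2 + R₁ ^ 2)
          (Eventually.of_forall fun n => ((hmeas n).aestronglyMeasurable).restrict)
          (Eventually.of_forall fun n => ae_of_all _ fun u hu => ?_)
          intervalIntegrable_const (ae_of_all _ fun u hu => ?_)
        · rw [Set.uIoc_of_le hΛ₀.le] at hu
          obtain ⟨h1, h2⟩ := hrb (φ n) u ⟨hu.1.le, hu.2⟩
          rw [Real.norm_eq_abs, abs_of_nonneg (by positivity)]
          have ha : (x (φ n) u).2.1 ^ 2 ≤ R₁ ^ 2 := by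
            rw [← sq_abs]; exact pow_le_pow_left₀ (abs_nonneg _) h1 2
          have hb : (x (φ n) u).2.2 ^ 2 ≤ R₁ ^ 2 := by
            rw [← sq_abs]; exact pow_le_pow_left₀ (abs_nonneg _) h2 2
          linarith only [ha, hb]
        · rw [Set.uIoc_of_le hΛ₀.le] at hu
          have hu' : u ∈ Icc 0 Λ₀ := ⟨hu.1.le, hu.2⟩
          have h1 : Tendsto (fun n => (x (φ n) u).2.1) atTop (𝓝 (ρL u)) :=
            tendsto_of_forall_eventually_norm_sub_le fun ε hε => (HC ε hε).mono fun n hn => by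
              rw [Real.norm_eq_abs]; exact (hn u hu').2.2.1
          have h2 : Tendsto (fun n => (x (φ n) u).2.2) atTop (𝓝 (ρR u)) :=
            tendsto_of_forall_eventually_norm_sub_le fun ε hε => (HC ε hε).mono fun n hn => by
              rw [Real.norm_eq_abs]; exact (hn u hu').2.2.2
          exact (h1.pow 2).add (h2.pow 2)
      have := tendsto_nhds_unique hB hA
      simpa [hyρ] using this
    have h := reservoir_eq_zero_of_integral_sq_eq_zero hyρc hΛ₀ hint0
    intro t ht
    exact h t ht
  -- pointwise limits of the reservoir variables
  have hrlim : ∀ u ∈ Icc 0 Λ₀, Tendsto (fun n => (x (φ n) u).2.1) atTop (𝓝 0) ∧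
      Tendsto (fun n => (x (φ n) u).2.2) atTop (𝓝 0) := by
    intro u hu
    obtain ⟨h1, h2⟩ := hρ0 u hu
    constructor
    · rw [← h1]
      exact tendsto_of_forall_eventually_norm_sub_le fun ε hε => (HC ε hε).mono fun n hn => by
        rw [Real.norm_eq_abs]; exact (hn u hu).2.2.1
    · rw [← h2]
      exact tendsto_of_forall_eventually_norm_sub_le fun ε hε => (HC ε hε).mono fun n hn => by
        rw [Real.norm_eq_abs]; exact (hn u hu).2.2.2
  ----------------------------------------------------------------
  -- Step 2: the limiting centre of mass is constant (reservoir equation)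
  ----------------------------------------------------------------
  have hQconst : ∀ s ∈ Icc 0 Λ₀, Sl s / N = Sl 0 / N := by
    intro s hs
    -- `Λ (q̃_0(s) - q̃_0(0)) = r̃_L(s) - r̃_L(0) - η_L(s) + E^{1/k₁-1/2} γ ∫₀ˢ r̃_L`
    have hid : ∀ n, Λ * ((x n s).1.1 ⟨0, hN⟩ - (x n 0).1.1 ⟨0, hN⟩) =
        ((x n s).2.1 - (x n 0).2.1 - (η n s).1) +
          Es n ^ (1 / k₁ - 1 / 2) * P.γ * ∫ u in (0:ℝ)..s, (x n u).2.1 := by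
      intro n
      obtain ⟨e1, -⟩ := hrIE n s hs
      have hq := hqIE n s hs ⟨0, hN⟩
      have hI : ∫ u in (0:ℝ)..s, (Y n (x n u)).2.1 =
          -(Es n ^ (1 / k₁ - 1 / 2) * P.γ) * (∫ u in (0:ℝ)..s, (x n u).2.1) +
            Λ * ∫ u in (0:ℝ)..s, (x n u).1.2 ⟨0, hN⟩ := by
        have e : ∀ u, (Y n (x n u)).2.1 = -(Es n ^ (1 / k₁ - 1 / 2) * P.γ) * (x n u).2.1 +
            Λ * (x n u).1.2 ⟨0, hN⟩ := fun u => by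
          rw [hY21, sum_ite_val_eq_zero hN]; ring
        simp_rw [e]
        have hc1 : Continuous fun u => (x n u).2.1 := continuous_fst.comp (continuous_snd.comp (hxc n))
        have hc2 : Continuous fun u => (x n u).1.2 ⟨0, hN⟩ :=
          (continuous_apply _).comp (continuous_snd.comp (continuous_fst.comp (hxc n)))
        rw [intervalIntegral.integral_add ((hc1.const_mul _).intervalIntegrable _ _)
          ((hc2.const_mul _).intervalIntegrable _ _), intervalIntegral.integral_const_mul,
          intervalIntegral.integral_const_mul]
      rw [hI] at e1
      rw [hq]
      linarith only [e1]
    -- pass to the limit along `φ`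
    have hL : Tendsto (fun n => Λ * ((x (φ n) s).1.1 ⟨0, hN⟩ - (x (φ n) 0).1.1 ⟨0, hN⟩)) atTop
        (𝓝 (Λ * (Sl s / N - Sl 0 / N))) := by
      have hq : ∀ u ∈ Icc 0 Λ₀, Tendsto (fun n => (x (φ n) u).1.1 ⟨0, hN⟩) atTop (𝓝 (Sl u / N)) :=
        fun u hu => tendsto_of_forall_eventually_norm_sub_le fun ε hε => (HQ ε hε).mono fun n hn => by
          rw [Real.norm_eq_abs]; exact hn u hu ⟨0, hN⟩
      exact ((hq s hs).sub (hq 0 h0m)).const_mul Λ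
    have hR : Tendsto (fun n => ((x (φ n) s).2.1 - (x (φ n) 0).2.1 - (η (φ n) s).1) +
        Es (φ n) ^ (1 / k₁ - 1 / 2) * P.γ * ∫ u in (0:ℝ)..s, (x (φ n) u).2.1) atTop (𝓝 0) := by
      have h1 : Tendsto (fun n => (x (φ n) s).2.1 - (x (φ n) 0).2.1 - (η (φ n) s).1) atTop (𝓝 0) := by
        have hηt : Tendsto (fun n => (η (φ n) s).1) atTop (𝓝 0) := by
          refine squeeze_zero_norm (fun n => ?_) (hδ.comp hφt)
          rw [Real.norm_eq_abs]; exact (hη1 (φ n) s hs).1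
        have := ((hrlim s hs).1.sub (hrlim 0 h0m).1).sub hηt
        simpa using this
      -- the friction term: coefficient `≤ 1`, integral `→ 0`
      have hI : Tendsto (fun n => ∫ u in (0:ℝ)..s, (x (φ n) u).2.1) atTop (𝓝 0) := by
        have h := intervalIntegral.tendsto_integral_filter_of_dominated_convergence (μ := volume)
          (a := 0) (b := s) (F := fun n u => (x (φ n) u).2.1) (f := fun _ => 0) (fun _ => R₁)
          (Eventually.of_forall fun n => ((continuous_fst.comp (continuous_snd.comp (hxc (φ n)))).aestronglyMeasurable).restrict)
          (Eventually.of_forall fun n => ae_of_all _ fun u hu => by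
            rw [Set.uIoc_of_le hs.1] at hu
            rw [Real.norm_eq_abs]; exact (hrb (φ n) u ⟨hu.1.le, hu.2.trans hs.2⟩).1)
          intervalIntegrable_const (ae_of_all _ fun u hu => by
            rw [Set.uIoc_of_le hs.1] at hu
            exact (hrlim u ⟨hu.1.le, hu.2.trans hs.2⟩).1)
        simpa using h
      have h2 : Tendsto (fun n => Es (φ n) ^ (1 / k₁ - 1 / 2) * P.γ * ∫ u in (0:ℝ)..s, (x (φ n) u).2.1)
          atTop (𝓝 0) := by
        have hb : Tendsto (fun n => |P.γ| * ‖∫ u in (0:ℝ)..s, (x (φ n) u).2.1‖) atTop (𝓝 0) := by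
          simpa using (hI.norm).const_mul |P.γ|
        refine squeeze_zero_norm (fun n => ?_) hb
        rw [norm_mul, norm_mul, Real.norm_eq_abs, Real.norm_eq_abs, abs_of_nonneg (hcr0 _)]
        have h3 : Es (φ n) ^ (1 / k₁ - 1 / 2) * |P.γ| ≤ |P.γ| := by
          have := mul_le_mul_of_nonneg_right (hcr1 (φ n)) hγ'
          rwa [one_mul] at this
        exact mul_le_mul_of_nonneg_right h3 (norm_nonneg _)
      simpa using h1.add h2
    have hL' : Tendsto (fun n => Λ * ((x (φ n) s).1.1 ⟨0, hN⟩ - (x (φ n) 0).1.1 ⟨0, hN⟩)) atTop (𝓝 0) := by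
      refine hR.congr fun n => ?_
      exact (hid (φ n)).symm
    have := tendsto_nhds_unique hL hL'
    rcases mul_eq_zero.1 this with h | h
    · exact absurd h hΛ
    · linarith only [h]
  ----------------------------------------------------------------
  -- Step 3: the limiting total momentum vanishes (`S' = P`, `S` constant)
  ----------------------------------------------------------------
  have hSIE_lim : ∀ t ∈ Icc 0 Λ₀, Sl t = Sl 0 + ∫ u in (0:ℝ)..t, Pl u := by
    intro t ht
    have hA : Tendsto (fun n => Sq (φ n) t) atTop (𝓝 (Sl t)) := (continuous_fst.tendsto _).comp (hgpt t ht)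
    have hS0 : Tendsto (fun n => Sq (φ n) 0) atTop (𝓝 (Sl 0)) := (continuous_fst.tendsto _).comp (hgpt 0 h0m)
    have hI : Tendsto (fun n => ∫ u in (0:ℝ)..t, Pm (φ n) u) atTop (𝓝 (∫ u in (0:ℝ)..t, Pl u)) := by
      refine intervalIntegral.tendsto_integral_filter_of_dominated_convergence (fun _ => N * Cp)
        (Eventually.of_forall fun n => ((hPmc (φ n)).aestronglyMeasurable).restrict)
        (Eventually.of_forall fun n => ae_of_all _ fun u hu => ?_)
        intervalIntegrable_const (ae_of_all _ fun u hu => ?_)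
      · rw [Set.uIoc_of_le ht.1] at hu
        rw [Real.norm_eq_abs]; exact hPb (φ n) u ⟨hu.1.le, hu.2.trans ht.2⟩
      · rw [Set.uIoc_of_le ht.1] at hu
        exact (continuous_fst.tendsto _).comp ((continuous_snd.tendsto _).comp (hgpt u ⟨hu.1.le, hu.2.trans ht.2⟩))
    have hB : Tendsto (fun n => Sq (φ n) t) atTop (𝓝 (Sl 0 + ∫ u in (0:ℝ)..t, Pl u)) := by
      have : (fun n => Sq (φ n) t) = fun n => Sq (φ n) 0 + ∫ u in (0:ℝ)..t, Pm (φ n) u :=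
        funext fun n => hSIE (φ n) t ht
      rw [this]; exact hS0.add hI
    exact tendsto_nhds_unique hA hB
  have hPl0 : ∀ t ∈ Icc 0 Λ₀, Pl t = 0 := by
    refine eqOn_zero_of_forall_integral_eq_zero hPlc hΛ₀ fun t ht => ?_
    have h1 := hSIE_lim t ht
    have h2 : Sl t = Sl 0 := by
      have := hQconst t ht
      rw [div_eq_div_iff hNne hNne] at this
      exact mul_right_cancel₀ hNne this
    linarith only [h1, h2]
  ----------------------------------------------------------------
  -- Step 4: the limiting centre of mass is a critical point of `U_∞`, hence `0`
  ----------------------------------------------------------------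
  obtain ⟨Q₀, hQ₀⟩ : ∃ Q₀ : ℝ, Q₀ = Sl 0 / N := ⟨_, rfl⟩
  have hQ₀B : |Q₀| ≤ B := by rw [hQ₀]; exact hQB 0 h0m
  have hxlim : ∀ u ∈ Icc 0 Λ₀, ∀ i, Tendsto (fun n => (x (φ n) u).1.1 i) atTop (𝓝 Q₀) := by
    intro u hu i
    rw [hQ₀, ← hQconst u hu]
    exact tendsto_of_forall_eventually_norm_sub_le fun ε hε => (HQ ε hε).mono fun n hn => by
      rw [Real.norm_eq_abs]; exact hn u hu i
  have hcrit : RBGrowth.limitForce hU.coeff k₁ Q₀ = 0 := by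
    -- pass to the limit in `P(Λ₀) = P(0) + ∫₀^{Λ₀} F`: `F → -N U_∞'(Q₀)` pointwise, boundedly
    obtain ⟨LU, hLU, hlipU⟩ := hU.exists_forall_abs_limitForce_sub_le hk₁ B
    have hFlim : ∀ u ∈ Icc 0 Λ₀, Tendsto (fun n => F (φ n) u) atTop
        (𝓝 (-(N * RBGrowth.limitForce hU.coeff k₁ Q₀))) := by
      intro u hu
      refine tendsto_of_forall_eventually_norm_sub_le fun ε hε => ?_
      -- split `ε` between the force convergence, the tight molecule and the reservoir term
      set e₁ : ℝ := ε / (3 * N) with he₁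
      have he₁0 : 0 < e₁ := div_pos hε (mul_pos (by norm_num) hN')
      set e₂ : ℝ := ε / (3 * (|Λ| + 1) * (2 * N)) with he₂
      have he₂0 : 0 < e₂ := div_pos hε (mul_pos (mul_pos (by norm_num) (by positivity)) (mul_pos two_pos hN'))
      have hid1 : (N : ℝ) * (2 * e₁) = 2 * ε / 3 := by rw [he₁]; field_simp
      have hid2 : |Λ| * (N * (e₂ + e₂)) = |Λ| * ε / (3 * (|Λ| + 1)) := by rw [he₂]; field_simp; ring
      have hid3 : |Λ| * ε / (3 * (|Λ| + 1)) ≤ ε / 3 := by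
        rw [div_le_div_iff₀ (by positivity) (by positivity)]
        nlinarith only [hΛ', hε.le]
      have h1 := hEφ.eventually (hU.eventually_forall_abs_deriv_scaledPot_sub_limitForce_le hk₁ B he₁0)
      have h2 := HQ (e₁ / (LU + 1)) (div_pos he₁0 (by linarith only [hLU]))
      have h3 := eventually_abs_sub_le_of_tendsto (hrlim u hu).1 he₂0
      have h4 := eventually_abs_sub_le_of_tendsto (hrlim u hu).2 he₂0
      filter_upwards [h1, h2, h3, h4] with n h1 h2 h3 h4
      rw [Real.norm_eq_abs]
      simp only [hF]
      rw [hY12]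
      obtain ⟨hqB, -, -, -, -, -⟩ := hxb (φ n) u hu
      rw [sub_zero] at h3 h4
      -- the pinning forces: each term is within `2 e₁` of `F_∞(Q₀)`
      have hforce : ∀ i, |deriv (RBGrowth.scaledPot P.U k₁ (Es (φ n))) ((x (φ n) u).1.1 i) -
          RBGrowth.limitForce hU.coeff k₁ Q₀| ≤ 2 * e₁ := by
        intro i
        have hqi := hqB i
        have a1 := h1 ((x (φ n) u).1.1 i) (abs_le.1 hqi)
        have a2 := hlipU ((x (φ n) u).1.1 i) (abs_le.1 hqi) Q₀ (abs_le.1 hQ₀B)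
        have a3 := h2 u hu i
        rw [hQconst u hu, ← hQ₀] at a3
        have a4 : LU * |(x (φ n) u).1.1 i - Q₀| ≤ e₁ := by
          calc LU * |(x (φ n) u).1.1 i - Q₀| ≤ LU * (e₁ / (LU + 1)) := mul_le_mul_of_nonneg_left a3 hLU
            _ ≤ e₁ := by
                rw [mul_div_assoc', div_le_iff₀ (by linarith only [hLU])]
                nlinarith only [he₁0.le, hLU]
        calc |deriv (RBGrowth.scaledPot P.U k₁ (Es (φ n))) ((x (φ n) u).1.1 i) - RBGrowth.limitForce hU.coeff k₁ Q₀|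
            ≤ |deriv (RBGrowth.scaledPot P.U k₁ (Es (φ n))) ((x (φ n) u).1.1 i) -
                RBGrowth.limitForce hU.coeff k₁ ((x (φ n) u).1.1 i)| +
              |RBGrowth.limitForce hU.coeff k₁ ((x (φ n) u).1.1 i) - RBGrowth.limitForce hU.coeff k₁ Q₀| :=
              abs_sub_le _ _ _
          _ ≤ e₁ + e₁ := add_le_add a1 (a2.trans a4)
          _ = 2 * e₁ := by ring
      set A : ℝ := ∑ i, deriv (RBGrowth.scaledPot P.U k₁ (Es (φ n))) ((x (φ n) u).1.1 i) with hA
      set T : ℝ := N * RBGrowth.limitForce hU.coeff k₁ Q₀ with hT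
      set Rs : ℝ := ∑ i : Fin N, ((if i.val = 0 then (x (φ n) u).2.1 else 0) +
        (if i.val = N - 1 then (x (φ n) u).2.2 else 0)) with hRs
      have hsumF : |A - T| ≤ 2 * ε / 3 := by
        have e : A - T = ∑ i : Fin N, (deriv (RBGrowth.scaledPot P.U k₁ (Es (φ n))) ((x (φ n) u).1.1 i) -
              RBGrowth.limitForce hU.coeff k₁ Q₀) := by
          rw [hA, hT, Finset.sum_sub_distrib, Finset.sum_const, Finset.card_univ, Fintype.card_fin, nsmul_eq_mul]
        rw [e, ← hid1]
        refine (Finset.abs_sum_le_sum_abs _ _).trans ((Finset.sum_le_sum fun i _ => hforce i).trans ?_)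
        rw [Finset.sum_const, Finset.card_univ, Fintype.card_fin, nsmul_eq_mul]
      -- the reservoir term
      have hres : |Es (φ n) ^ (2 / k₁ - 1) * Λ * Rs| ≤ ε / 3 := by
        rw [abs_mul, abs_mul, abs_of_nonneg (hcp0 _)]
        have hsel : |Rs| ≤ N * (e₂ + e₂) :=
          (hRsel (φ n) u hu).trans (mul_le_mul_of_nonneg_left (add_le_add h3 h4) hN'.le)
        have h5 : Es (φ n) ^ (2 / k₁ - 1) * |Λ| ≤ |Λ| := by
          have := mul_le_mul_of_nonneg_right (hcp1 (φ n)) hΛ'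
          rwa [one_mul] at this
        calc Es (φ n) ^ (2 / k₁ - 1) * |Λ| * |Rs| ≤ |Λ| * (N * (e₂ + e₂)) :=
              mul_le_mul h5 hsel (abs_nonneg _) hΛ'
          _ = |Λ| * ε / (3 * (|Λ| + 1)) := hid2
          _ ≤ ε / 3 := hid3
      -- combine
      have e : -A - Es (φ n) ^ (2 / k₁ - 1) * Λ * Rs - -T = -(A - T) - Es (φ n) ^ (2 / k₁ - 1) * Λ * Rs := by ring
      rw [e]
      refine (abs_sub _ _).trans ?_
      rw [abs_neg]
      linarith only [hsumF, hres]
    -- the limit of `P(Λ₀) = P(0) + ∫₀^{Λ₀} F`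
    have hA : Tendsto (fun n => Pm (φ n) Λ₀) atTop (𝓝 (Pl Λ₀)) :=
      (continuous_fst.tendsto _).comp ((continuous_snd.tendsto _).comp (hgpt Λ₀ hΛm))
    have hP0 : Tendsto (fun n => Pm (φ n) 0) atTop (𝓝 (Pl 0)) :=
      (continuous_fst.tendsto _).comp ((continuous_snd.tendsto _).comp (hgpt 0 h0m))
    have hI : Tendsto (fun n => ∫ u in (0:ℝ)..Λ₀, F (φ n) u) atTop
        (𝓝 (∫ _u in (0:ℝ)..Λ₀, -(N * RBGrowth.limitForce hU.coeff k₁ Q₀))) := by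
      refine intervalIntegral.tendsto_integral_filter_of_dominated_convergence (fun _ => MP)
        (Eventually.of_forall fun n => ((hFc (φ n)).aestronglyMeasurable).restrict)
        (Eventually.of_forall fun n => ae_of_all _ fun u hu => ?_)
        intervalIntegrable_const (ae_of_all _ fun u hu => ?_)
      · rw [Set.uIoc_of_le hΛ₀.le] at hu
        rw [Real.norm_eq_abs]; exact hFb (φ n) u ⟨hu.1.le, hu.2⟩
      · rw [Set.uIoc_of_le hΛ₀.le] at hu
        exact hFlim u ⟨hu.1.le, hu.2⟩
    have hB : Tendsto (fun n => Pm (φ n) Λ₀) atTop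
        (𝓝 (Pl 0 + ∫ _u in (0:ℝ)..Λ₀, -(N * RBGrowth.limitForce hU.coeff k₁ Q₀))) := by
      have : (fun n => Pm (φ n) Λ₀) = fun n => Pm (φ n) 0 + ∫ u in (0:ℝ)..Λ₀, F (φ n) u :=
        funext fun n => hPIE (φ n) Λ₀ hΛm
      rw [this]; exact hP0.add hI
    have heq := tendsto_nhds_unique hA hB
    rw [hPl0 Λ₀ hΛm, hPl0 0 h0m, intervalIntegral.integral_const, smul_eq_mul, sub_zero] at heq
    -- `0 = 0 + Λ₀ · (-(N · F_∞(Q₀)))`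
    have : Λ₀ * (N * RBGrowth.limitForce hU.coeff k₁ Q₀) = 0 := by linarith only [heq]
    rcases mul_eq_zero.1 this with h | h
    · exact absurd h hΛ₀.ne'
    · rcases mul_eq_zero.1 h with h' | h'
      · exact absurd h' hNne
      · exact h'
  have hQ₀0 : Q₀ = 0 :=
    RBGrowth.limitForce_injective hU.coeff_pos hk₁
      (show RBGrowth.limitForce hU.coeff k₁ Q₀ = RBGrowth.limitForce hU.coeff k₁ 0 by
        rw [hcrit, RBGrowth.limitForce_zero])
  ----------------------------------------------------------------
  -- Step 5: the rescaled pinning energies at time `0` tend to `0` — contradiction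
  ----------------------------------------------------------------
  have hpinlim : Tendsto (fun n => (P.rbScaled k₁ (Es (φ n))).pinEnergy N (x (φ n) 0).1.1) atTop (𝓝 0) := by
    -- each term `Ũ_E(q̃_i(0)) → U_∞(0) = 0`
    have hterm : ∀ i, Tendsto (fun n => RBGrowth.scaledPot P.U k₁ (Es (φ n)) ((x (φ n) 0).1.1 i)) atTop (𝓝 0) := by
      intro i
      have hq := hxlim 0 h0m i
      rw [hQ₀0] at hq
      have hpot : Tendsto (fun n => RBGrowth.limitPot hU.coeff k₁ ((x (φ n) 0).1.1 i)) atTop (𝓝 0) := by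
        have h := ((RBGrowth.continuous_limitPot hU.coeff hk₁0).tendsto 0).comp hq
        rw [show RBGrowth.limitPot hU.coeff k₁ 0 = 0 by simp [RBGrowth.limitPot, Real.zero_rpow hk₁0.ne']] at h
        exact h
      refine tendsto_of_forall_eventually_norm_sub_le fun ε hε => ?_
      have h1 := hEφ.eventually (hU.eventually_forall_abs_scaledPot_sub_limitPot_le (by linarith) B
        (half_pos hε))
      have h2 := eventually_abs_sub_le_of_tendsto hpot (half_pos hε)
      filter_upwards [h1, h2] with n h1 h2
      rw [Real.norm_eq_abs, sub_zero]
      have a1 := h1 ((x (φ n) 0).1.1 i) (abs_le.1 ((hxb (φ n) 0 h0m).1 i))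
      rw [sub_zero] at h2
      calc |RBGrowth.scaledPot P.U k₁ (Es (φ n)) ((x (φ n) 0).1.1 i)|
          ≤ |RBGrowth.scaledPot P.U k₁ (Es (φ n)) ((x (φ n) 0).1.1 i) -
              RBGrowth.limitPot hU.coeff k₁ ((x (φ n) 0).1.1 i)| +
            |RBGrowth.limitPot hU.coeff k₁ ((x (φ n) 0).1.1 i)| := by
              have := abs_add_le (RBGrowth.scaledPot P.U k₁ (Es (φ n)) ((x (φ n) 0).1.1 i) -
                RBGrowth.limitPot hU.coeff k₁ ((x (φ n) 0).1.1 i)) (RBGrowth.limitPot hU.coeff k₁ ((x (φ n) 0).1.1 i))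
              rwa [sub_add_cancel] at this
        _ ≤ ε / 2 + ε / 2 := add_le_add a1 h2
        _ = ε := by ring
    have := tendsto_finsetSum (Finset.univ : Finset (Fin N)) fun i _ => hterm i
    rw [Finset.sum_const_zero] at this
    refine this.congr fun n => ?_
    simp [OscillatorChain.pinEnergy]
  -- the reservoir term at time `0` tends to `0` as well (`r̃(0) → 0`, coefficient `≤ 1`)
  have hreslim : Tendsto (fun n => Es (φ n) ^ (2 / k₁ - 1) *
      (((x (φ n) 0).2.1 ^ 2 + (x (φ n) 0).2.2 ^ 2) / 2)) atTop (𝓝 0) := by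
    have h0 : Tendsto (fun n => ((x (φ n) 0).2.1 ^ 2 + (x (φ n) 0).2.2 ^ 2) / 2) atTop (𝓝 0) := by
      have := (((hrlim 0 h0m).1.pow 2).add ((hrlim 0 h0m).2.pow 2)).div_const 2
      simpa using this
    have h0' : Tendsto (fun n => ‖((x (φ n) 0).2.1 ^ 2 + (x (φ n) 0).2.2 ^ 2) / 2‖) atTop (𝓝 0) := by
      simpa using h0.norm
    refine squeeze_zero_norm (fun n => ?_) h0'
    rw [norm_mul, Real.norm_eq_abs, abs_of_nonneg (hcp0 _)]
    exact mul_le_of_le_one_left (norm_nonneg _) (hcp1 _)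
  obtain ⟨n, hn1, hn2⟩ := ((hpinlim.eventually_lt_const (by norm_num : (0 : ℝ) < 3 / 16)).and
    (hreslim.eventually_lt_const (by norm_num : (0 : ℝ) < 1 / 8))).exists
  have hsplit := P.rbScaledEnergy_eq_split k₁ (Es (φ n)) N (x (φ n) 0)
  have hG := hG0 (φ n)
  have hregn := hreg (φ n)
  linarith only [hsplit, hG, hregn, hn1, hn2]

end Core

/-! ### The quantitative rescaled form -/

section Main

variable {P : OscillatorChain} {k₁ k₂ : ℝ} (hU : RBGrowth P.U k₁) (hV : RBGrowth P.V k₂)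
  (hk₁ : 2 ≤ k₁) (hk : k₁ < k₂) {Λ : ℝ} (hΛ : Λ ≠ 0) (hN : 0 < N) {Λ₀ : ℝ} (hΛ₀ : 0 < Λ₀)
include hU hV hk₁ hk hΛ hN hΛ₀

/-- **The dissipation bound in the pinning regime (CEHR Prop. 5.3, §5.2; RBT Cor. 3.6),
quantitative rescaled form, `2 ≤ k₁ < k₂`.** Fix `Λ₀ > 0` and an energy ceiling `M`. There are
`E₀ ≥ 1`, `δ₀ ∈ (0, 1]` and `ε₁ > 0` such that for every `E ≥ E₀`, every continuous solution
`x̃ = x̃(0) + (0, η̃) + ∫ Ỹ_E(x̃)` of the equations rescaled with the PINNING exponent `k₁` on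
`[0, Λ₀]`, with `G̃_E(x̃(0)) ≥ 1/2`, kinetic+interaction energy at most the pinning energy at time
`0`, `G̃_E ≤ M` on `[0, Λ₀]` and control `sup ‖η̃‖ ≤ δ₀`, one has `∫₀^{Λ₀}(r̃_L² + r̃_R²) ≥ ε₁`
(a large initial reservoir variable is handled directly: the `ṙ`-components of the drift are
bounded on `{G̃_E ≤ M}` even though the bond forces are stiff).
[cite: ReyBelletThomas2002, Thm 3.3, Cor 3.6 (proof)] -/
theorem pinning_dissipation_lower_bound (M : ℝ) :
    ∃ E₀ δ₀ ε₁ : ℝ, 1 ≤ E₀ ∧ 0 < δ₀ ∧ δ₀ ≤ 1 ∧ 0 < ε₁ ∧ ∀ E : ℝ, E₀ ≤ E →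
      ∀ (x : ℝ → RBPhaseSpace N) (η : ℝ → ℝ × ℝ), Continuous x →
        IsIntegralSolutionOn ((P.rbScaled k₁ E).rbDriftGen Λ N (E ^ (2 / k₁ - 1)) (E ^ (1 / k₁ - 1 / 2)))
          (fun s => x 0 + ((0 : PhaseSpace N), η s)) x Λ₀ →
        1 / 2 ≤ P.rbScaledEnergy k₁ E N (x 0) →
        (P.rbScaled k₁ E).intEnergy N (x 0).1 ≤ (P.rbScaled k₁ E).pinEnergy N (x 0).1.1 →
        (∀ s ∈ Icc 0 Λ₀, ‖η s‖ ≤ δ₀) → (∀ s ∈ Icc 0 Λ₀, P.rbScaledEnergy k₁ E N (x s) ≤ M) →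
        ε₁ ≤ ∫ s in (0 : ℝ)..Λ₀, ((x s).2.1 ^ 2 + (x s).2.2 ^ 2) := by
  have hk₁0 : 0 < k₁ := by linarith
  obtain ⟨B, BΔ, Cp, Cr, MU, -, -, hCp, hCr, -, hbd⟩ := pinning_scaled_apriori (N := N) hU hV hk₁ hk.le M
  -- the `ṙ`-bound `M_r` on `{G̃_E ≤ M}`
  set Mr : ℝ := |P.γ| * Cr + |Λ| * (N * Cp) with hMr
  have hMr0 : 0 ≤ Mr := by positivity
  have hYr : ∀ E : ℝ, 1 ≤ E → ∀ z : RBPhaseSpace N, P.rbScaledEnergy k₁ E N z ≤ M →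
      |((P.rbScaled k₁ E).rbDriftGen Λ N (E ^ (2 / k₁ - 1)) (E ^ (1 / k₁ - 1 / 2)) z).2.1| ≤ Mr ∧
      |((P.rbScaled k₁ E).rbDriftGen Λ N (E ^ (2 / k₁ - 1)) (E ^ (1 / k₁ - 1 / 2)) z).2.2| ≤ Mr := by
    intro E hE z hz
    obtain ⟨-, -, hp, hr1, hr2, -⟩ := hbd E hE z hz
    have hE0 : 0 < E := by linarith
    have hcr0 : 0 ≤ E ^ (1 / k₁ - 1 / 2) := Real.rpow_nonneg hE0.le _
    have hΛ' := abs_nonneg Λ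
    have hγ' := abs_nonneg P.γ
    constructor
    · show |-(E ^ (1 / k₁ - 1 / 2) * P.γ * z.2.1) + Λ * ∑ i : Fin N, (if i.val = 0 then z.1.2 i else 0)| ≤ Mr
      refine (abs_add_le _ _).trans ?_
      rw [abs_neg, abs_mul, abs_mul, abs_of_nonneg hcr0, abs_mul]
      have h1 : E ^ (1 / k₁ - 1 / 2) * |P.γ| * |z.2.1| ≤ |P.γ| * Cr := by
        rw [mul_comm (E ^ (1 / k₁ - 1 / 2)) |P.γ|, mul_assoc]
        exact mul_le_mul_of_nonneg_left hr1 hγ'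
      have h2 : |Λ| * |∑ i : Fin N, (if i.val = 0 then z.1.2 i else 0)| ≤ |Λ| * (N * Cp) :=
        mul_le_mul_of_nonneg_left (abs_sum_ite_le hCp hp _) hΛ'
      rw [hMr]; linarith
    · show |-(E ^ (1 / k₁ - 1 / 2) * P.γ * z.2.2) + Λ * ∑ i : Fin N, (if i.val = N - 1 then z.1.2 i else 0)| ≤ Mr
      refine (abs_add_le _ _).trans ?_
      rw [abs_neg, abs_mul, abs_mul, abs_of_nonneg hcr0, abs_mul]
      have h1 : E ^ (1 / k₁ - 1 / 2) * |P.γ| * |z.2.2| ≤ |P.γ| * Cr := by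
        rw [mul_comm (E ^ (1 / k₁ - 1 / 2)) |P.γ|, mul_assoc]
        exact mul_le_mul_of_nonneg_left hr2 hγ'
      have h2 : |Λ| * |∑ i : Fin N, (if i.val = N - 1 then z.1.2 i else 0)| ≤ |Λ| * (N * Cp) :=
        mul_le_mul_of_nonneg_left (abs_sum_ite_le hCp hp _) hΛ'
      rw [hMr]; linarith
  set R₀ : ℝ := 2 + Mr * Λ₀ with hR₀
  -- Case A (bounded initial reservoir variables): the compactness argument
  have caseA : ∃ E₀ δ₀ ε₁ : ℝ, 1 ≤ E₀ ∧ 0 < δ₀ ∧ δ₀ ≤ 1 ∧ 0 < ε₁ ∧ ∀ E : ℝ, E₀ ≤ E →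
      ∀ (x : ℝ → RBPhaseSpace N) (η : ℝ → ℝ × ℝ), Continuous x →
        IsIntegralSolutionOn ((P.rbScaled k₁ E).rbDriftGen Λ N (E ^ (2 / k₁ - 1)) (E ^ (1 / k₁ - 1 / 2)))
          (fun s => x 0 + ((0 : PhaseSpace N), η s)) x Λ₀ →
        1 / 2 ≤ P.rbScaledEnergy k₁ E N (x 0) →
        (P.rbScaled k₁ E).intEnergy N (x 0).1 ≤ (P.rbScaled k₁ E).pinEnergy N (x 0).1.1 →
        |(x 0).2.1| ≤ R₀ → |(x 0).2.2| ≤ R₀ →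
        (∀ s ∈ Icc 0 Λ₀, ‖η s‖ ≤ δ₀) → (∀ s ∈ Icc 0 Λ₀, P.rbScaledEnergy k₁ E N (x s) ≤ M) →
        ε₁ ≤ ∫ s in (0 : ℝ)..Λ₀, ((x s).2.1 ^ 2 + (x s).2.2 ^ 2) := by
    by_contra H
    have H' : ∀ n : ℕ, ∃ (E : ℝ) (x : ℝ → RBPhaseSpace N) (η : ℝ → ℝ × ℝ), (n : ℝ) + 1 ≤ E ∧
        Continuous x ∧
        IsIntegralSolutionOn ((P.rbScaled k₁ E).rbDriftGen Λ N (E ^ (2 / k₁ - 1)) (E ^ (1 / k₁ - 1 / 2)))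
          (fun s => x 0 + ((0 : PhaseSpace N), η s)) x Λ₀ ∧
        1 / 2 ≤ P.rbScaledEnergy k₁ E N (x 0) ∧
        (P.rbScaled k₁ E).intEnergy N (x 0).1 ≤ (P.rbScaled k₁ E).pinEnergy N (x 0).1.1 ∧
        |(x 0).2.1| ≤ R₀ ∧ |(x 0).2.2| ≤ R₀ ∧
        (∀ s ∈ Icc 0 Λ₀, ‖η s‖ ≤ 1 / ((n : ℝ) + 1)) ∧
        (∀ s ∈ Icc 0 Λ₀, P.rbScaledEnergy k₁ E N (x s) ≤ M) ∧
        ∫ s in (0 : ℝ)..Λ₀, ((x s).2.1 ^ 2 + (x s).2.2 ^ 2) < 1 / ((n : ℝ) + 1) := by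
      intro n
      by_contra h'
      apply H
      have hn1 : (1 : ℝ) ≤ (n : ℝ) + 1 := by
        have : (0 : ℝ) ≤ n := Nat.cast_nonneg n
        linarith
      refine ⟨(n : ℝ) + 1, 1 / ((n : ℝ) + 1), 1 / ((n : ℝ) + 1), hn1, by positivity,
        (div_le_one (by positivity)).2 hn1, by positivity,
        fun E hE x η hxc hIE hG hrg hr1 hr2 hη hGM => ?_⟩
      by_contra hlt
      exact h' ⟨E, x, η, hE, hxc, hIE, hG, hrg, hr1, hr2, hη, hGM, not_le.1 hlt⟩
    choose Es xs ηs hEs hxsc hIE hG hrg hr1 hr2 hηs hGMs hlt using H'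
    have hn1 : ∀ n : ℕ, (1 : ℝ) ≤ (n : ℝ) + 1 := fun n => by
      have : (0 : ℝ) ≤ n := Nat.cast_nonneg n
      linarith
    have hEt : Tendsto Es atTop atTop :=
      tendsto_atTop_mono hEs (tendsto_natCast_atTop_atTop.atTop_add tendsto_const_nhds)
    refine pinning_core_seq hU hV hk₁ hk hΛ hN hΛ₀ (M := M) (R₀ := R₀) (Es := Es)
      (δ := fun n => 1 / ((n : ℝ) + 1)) (x := xs) (η := ηs) (fun n => (hn1 n).trans (hEs n)) hEt
      tendsto_one_div_add_atTop_nhds_zero_nat (fun n => (div_le_one (by positivity)).2 (hn1 n))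
      hxsc hIE hG hrg (fun n => ⟨hr1 n, hr2 n⟩) hηs hGMs ?_
    refine squeeze_zero (fun n => intervalIntegral.integral_nonneg hΛ₀.le fun s _ => by positivity)
      (fun n => (hlt n).le) tendsto_one_div_add_atTop_nhds_zero_nat
  obtain ⟨E₀, δ₀, ε₁, hE₀, hδ₀, hδ₁, hε₁, hA⟩ := caseA
  refine ⟨E₀, δ₀, min ε₁ Λ₀, hE₀, hδ₀, hδ₁, lt_min hε₁ hΛ₀, fun E hE x η hxc hIE hG hrg hη hGM => ?_⟩
  by_cases hr : |(x 0).2.1| ≤ R₀ ∧ |(x 0).2.2| ≤ R₀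
  · exact (min_le_left _ _).trans (hA E hE x η hxc hIE hG hrg hr.1 hr.2 hη hGM)
  · -- Case B (a large initial reservoir variable): it stays `≥ 1` on `[0, Λ₀]`
    have hE1 : 1 ≤ E := hE₀.trans hE
    have hE0 : 0 < E := by linarith
    have hYxc : Continuous fun s => (P.rbScaled k₁ E).rbDriftGen Λ N (E ^ (2 / k₁ - 1)) (E ^ (1 / k₁ - 1 / 2)) (x s) :=
      (continuous_rbDriftGen_rbScaled₂ hU hV k₁ hE0 Λ N _ _).comp hxc
    have hdev := reservoir_deviation_le' hYxc hIE (fun s hs => hYr E hE1 (x s) (hGM s hs))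
    have hηc : ∀ s ∈ Icc 0 Λ₀, |(η s).1| ≤ 1 ∧ |(η s).2| ≤ 1 := fun s hs =>
      ⟨((Real.norm_eq_abs _).symm.le.trans (norm_fst_le (η s))).trans ((hη s hs).trans hδ₁),
        ((Real.norm_eq_abs _).symm.le.trans (norm_snd_le (η s))).trans ((hη s hs).trans hδ₁)⟩
    have hlow : ∀ s ∈ Icc 0 Λ₀, (1 : ℝ) ≤ (x s).2.1 ^ 2 + (x s).2.2 ^ 2 := by
      intro s hs
      obtain ⟨d1, d2⟩ := hdev s hs
      obtain ⟨n1, n2⟩ := hηc s hs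
      rcases not_and_or.1 hr with h | h
      · have h' : R₀ < |(x 0).2.1| := not_le.1 h
        have : 1 ≤ |(x s).2.1| := by
          have := abs_sub_abs_le_abs_sub (x 0).2.1 (x s).2.1
          have e : (x 0).2.1 - (x s).2.1 = -((x s).2.1 - (x 0).2.1 - (η s).1) - (η s).1 := by ring
          rw [e] at this
          have h3 : |-((x s).2.1 - (x 0).2.1 - (η s).1)| + |(η s).1| ≤ Mr * Λ₀ + 1 := by
            rw [abs_neg]; exact add_le_add d1 n1
          have := (this.trans (abs_sub _ _)).trans h3
          rw [hR₀] at h'; linarith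
        nlinarith [abs_nonneg (x s).2.1, sq_abs (x s).2.1, sq_nonneg (x s).2.2]
      · have h' : R₀ < |(x 0).2.2| := not_le.1 h
        have : 1 ≤ |(x s).2.2| := by
          have := abs_sub_abs_le_abs_sub (x 0).2.2 (x s).2.2
          have e : (x 0).2.2 - (x s).2.2 = -((x s).2.2 - (x 0).2.2 - (η s).2) - (η s).2 := by ring
          rw [e] at this
          have h3 : |-((x s).2.2 - (x 0).2.2 - (η s).2)| + |(η s).2| ≤ Mr * Λ₀ + 1 := by
            rw [abs_neg]; exact add_le_add d2 n2
          have := (this.trans (abs_sub _ _)).trans h3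
          rw [hR₀] at h'; linarith
        nlinarith [abs_nonneg (x s).2.2, sq_abs (x s).2.2, sq_nonneg (x s).2.1]
    have hcont : Continuous fun s => (x s).2.1 ^ 2 + (x s).2.2 ^ 2 := by fun_prop
    have hmono := intervalIntegral.integral_mono_on (μ := volume) hΛ₀.le intervalIntegrable_const
      (hcont.intervalIntegrable _ _) hlow
    rw [intervalIntegral.integral_const, smul_eq_mul, mul_one, sub_zero] at hmono
    exact (min_le_right _ _).trans hmono

end Main

end Literature.MathematicalPhysics.KineticTheory.HeatConduction

end
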